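import Summits.Ventures.HodgeRepro2.T5SU11JacobiMeanPhaseOutside

/-!
# The rate chapter OUTSIDE `0 ≤ λ ≤ 2`, part 1: `|k ⟨log|a|⟩ − 1| ≤ (16 + 8c' + 20c'²)/k` and
`|k² ⟨(log|a|)²⟩ − 2| ≤ (256 + 64c' + 108c'² + 32c'⁴)/k` for `λ ≥ 2` (and `λ ≤ 0`), `c' = λ(λ − 2)/2`

`T5SU11JacobiPhaseLowerOutside` pins the moment integrals for `λ ≥ 2`, `r = k − 2 > c'`:
`n!/r^{n+1} + c' (n+1)!/r^{n+2} ≤ ∫_0^∞ sⁿ e^{−rs} Φ_λ(s) ds ≤ n!/(r − c')^{n+1}`, and `T5SU11JacobiMeanPhaseOutside`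
the mean phase, `(r + 2c')(r − c')/r³ ≤ ⟨log|a|⟩_{k,λ} ≤ r²/((r − c')²(r + c'))`. For `k ≥ 2c' + 4` (so that
`r − c' ≥ r/2`) the same bookkeeping as in `T5SU11JacobiMeanPhaseRate` (the Jensen range) gives explicit rates with
constants polynomial in `c'`:

* the four envelope inequalities in `r` (`upper_mean_envelope_le`, `lower_mean_envelope_le`,
  `upper_second_envelope_le`, `lower_second_envelope_le`: the rational envelopes minus their limits are `≤ C(c')/(r + 2)`);
* **`|k ⟨log|a|⟩_{k,λ} − 1| ≤ (16 + 8c' + 20c'²)/k`** (`abs_mul_mean_phase_sub_one_le_of_two_le`, `_of_nonpos`);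
* `2(r + 3c')(r − c')/r⁴ ≤ ⟨(log|a|)²⟩_{k,λ} ≤ 2r²/((r − c')³(r + c'))` (`second_moment_phase_ge_of_two_le`,
  `second_moment_phase_le_of_two_le`) and
  **`|k² ⟨(log|a|)²⟩_{k,λ} − 2| ≤ (256 + 64c' + 108c'² + 32c'⁴)/k`** (`abs_sq_mul_second_moment_sub_two_le_of_two_le`).

The variance and the covariance are `T5SU11JacobiCovarianceRateOutside`. Constants explicit, not optimised.
Nothing is claimed about (N).

Blind lane: Mathlib + the HodgeRepro2 prefix only; no sorry; axioms ⊆ {propext, Classical.choice,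
Quot.sound}.
-/

namespace Summit.Ventures.HodgeRepro2.T5SU11JacobiMeanPhaseRateOutside

open MeasureTheory MeasureTheory.Measure Metric Set Filter Topology
open T5SU11Unimodular T5SU11Fibration T5SU11Cartan T5SU11OneParameter T5SU11CartanProjection T5HaarCircle
  T5BergmanCoefficient T5SU11FibrationHaar T5SU11SphericalFunction T5SU11SphericalSymmetry
  T5SU11SphericalBounds T5SU11SphericalContinuous T5SU11JacobiLaplacePhase T5SU11PhaseLawLintegral
  T5SU11JacobiWeightDerivAll T5SU11JacobiPhaseTailGroup T5SU11JacobiPhaseLawRate T5SU11JacobiMeanPhaseRate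
  T5SU11JacobiPhaseLawRateOutside T5SU11JacobiWeightRate T5SU11JacobiPhaseLowerOutside
  T5SU11JacobiMeanPhaseOutside
open scoped Real

/-! ### The elementary envelope inequalities, `r ≥ 2c + 2`, `c ≥ 0` -/

/-- `(r + 2) r²/((r − c)²(r + c)) − 1 ≤ (16 + 8c + 8c²)/(r + 2)` for `c ≥ 0`, `r ≥ 2c + 2`. -/
theorem upper_mean_envelope_le {r c : ℝ} (hc : 0 ≤ c) (hr : 2 * c + 2 ≤ r) :
    (r + 2) * (r ^ 2 / ((r - c) ^ 2 * (r + c))) - 1 ≤ (16 + 8 * c + 8 * c ^ 2) / (r + 2) := by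
  have hr0 : 0 < r := by linarith
  have hrc : r / 2 ≤ r - c := by linarith
  have hrc0 : 0 < r - c := by linarith
  have hD : r ^ 3 ≤ 4 * ((r - c) ^ 2 * (r + c)) := by
    have h1 : (r / 2) ^ 2 ≤ (r - c) ^ 2 := pow_le_pow_left₀ (by positivity) hrc 2
    have h2 : r ≤ r + c := by linarith
    calc r ^ 3 = 4 * ((r / 2) ^ 2 * r) := by ring
      _ ≤ 4 * ((r - c) ^ 2 * (r + c)) := by gcongr
  have hDpos : 0 < (r - c) ^ 2 * (r + c) := by positivity
  have e : (r + 2) * (r ^ 2 / ((r - c) ^ 2 * (r + c))) - 1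
      = ((2 + c) * r ^ 2 + c ^ 2 * r - c ^ 3) / ((r - c) ^ 2 * (r + c)) := by
    field_simp
    ring
  rw [e, div_le_div_iff₀ hDpos (by positivity)]
  -- `((2 + c) r² + c² r − c³)(r + 2) ≤ (8 + 4c + 4c²)(r − c)²(r + c)`: use `(r + 2) ≤ 2r`, `r ≥ 1`, `hD`
  have hr1 : 1 ≤ r := by linarith
  have hk : r + 2 ≤ 2 * r := by linarith
  have hN : (2 + c) * r ^ 2 + c ^ 2 * r - c ^ 3 ≤ (2 + c + c ^ 2) * r ^ 2 := by
    nlinarith [pow_nonneg hc 3, mul_le_mul_of_nonneg_left hr1 (sq_nonneg c)]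
  have hN0 : 0 ≤ (2 + c + c ^ 2) * r ^ 2 := by positivity
  have hN0' : 0 ≤ (2 + c) * r ^ 2 + c ^ 2 * r - c ^ 3 := by
    nlinarith [mul_le_mul_of_nonneg_left (show c ≤ r by linarith) (sq_nonneg c)]
  calc ((2 + c) * r ^ 2 + c ^ 2 * r - c ^ 3) * (r + 2)
      ≤ ((2 + c + c ^ 2) * r ^ 2) * (2 * r) := mul_le_mul hN hk (by linarith) hN0
    _ = (2 + c + c ^ 2) / 2 * (4 * (r ^ 2 * r)) := by ring
    _ ≤ (2 + c + c ^ 2) / 2 * (4 * (4 * ((r - c) ^ 2 * (r + c)))) :=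
        mul_le_mul_of_nonneg_left (by nlinarith [hD]) (by positivity)
    _ = (16 + 8 * c + 8 * c ^ 2) * ((r - c) ^ 2 * (r + c)) := by ring

/-- `1 − (r + 2)(r + 2c)(r − c)/r³ ≤ 12c²/(r + 2)` for `c ≥ 0`, `r ≥ 2c + 2`. -/
theorem lower_mean_envelope_le {r c : ℝ} (hc : 0 ≤ c) (hr : 2 * c + 2 ≤ r) :
    1 - (r + 2) * ((r + 2 * c) * (r - c) / r ^ 3) ≤ 12 * c ^ 2 / (r + 2) := by
  have hr0 : 0 < r := by linarith
  have hr1 : 1 ≤ r := by linarith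
  have e : 1 - (r + 2) * ((r + 2 * c) * (r - c) / r ^ 3)
      = (-(2 + c) * r ^ 2 + (2 * c ^ 2 - 2 * c) * r + 4 * c ^ 2) / r ^ 3 := by
    field_simp
    ring
  rw [e, div_le_div_iff₀ (by positivity) (by positivity)]
  -- numerator `≤ 6c² r`, and `6c² r (r + 2) ≤ 12 c² r³` since `r + 2 ≤ 2r ≤ 2r²`
  have hN : -(2 + c) * r ^ 2 + (2 * c ^ 2 - 2 * c) * r + 4 * c ^ 2 ≤ 6 * c ^ 2 * r := by
    nlinarith [mul_nonneg hc (sq_nonneg r), sq_nonneg r, mul_nonneg hc hr0.le,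
      mul_le_mul_of_nonneg_left hr1 (sq_nonneg c)]
  have hk : r + 2 ≤ 2 * r ^ 2 := by nlinarith
  calc (-(2 + c) * r ^ 2 + (2 * c ^ 2 - 2 * c) * r + 4 * c ^ 2) * (r + 2)
      ≤ 6 * c ^ 2 * r * (2 * r ^ 2) := by
        rcases le_or_gt 0 (-(2 + c) * r ^ 2 + (2 * c ^ 2 - 2 * c) * r + 4 * c ^ 2) with hpos | hneg
        · exact mul_le_mul hN hk (by linarith) (by positivity)
        · nlinarith [mul_nonneg (mul_nonneg (by norm_num : (0 : ℝ) ≤ 6) (sq_nonneg c)) hr0.le,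
            sq_nonneg r]
    _ = 12 * c ^ 2 * r ^ 3 := by ring

/-- `(r + 2)² · 2r²/((r − c)³(r + c)) − 2 ≤ (256 + 64c + 32c⁴)/(r + 2)` for `c ≥ 0`, `r ≥ 2c + 2`. -/
theorem upper_second_envelope_le {r c : ℝ} (hc : 0 ≤ c) (hr : 2 * c + 2 ≤ r) :
    (r + 2) ^ 2 * (2 * r ^ 2 / ((r - c) ^ 3 * (r + c))) - 2 ≤ (256 + 64 * c + 32 * c ^ 4) / (r + 2) := by
  have hr0 : 0 < r := by linarith
  have hr1 : 1 ≤ r := by linarith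
  have hrc : r / 2 ≤ r - c := by linarith
  have hrc0 : 0 < r - c := by linarith
  have hD : r ^ 4 ≤ 8 * ((r - c) ^ 3 * (r + c)) := by
    have h1 : (r / 2) ^ 3 ≤ (r - c) ^ 3 := pow_le_pow_left₀ (by positivity) hrc 3
    have h2 : r ≤ r + c := by linarith
    calc r ^ 4 = 8 * ((r / 2) ^ 3 * r) := by ring
      _ ≤ 8 * ((r - c) ^ 3 * (r + c)) := by gcongr
  have hDpos : 0 < (r - c) ^ 3 * (r + c) := by positivity
  have e : (r + 2) ^ 2 * (2 * r ^ 2 / ((r - c) ^ 3 * (r + c))) - 2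
      = 2 * ((4 + 2 * c) * r ^ 3 + 4 * r ^ 2 - 2 * c ^ 3 * r + c ^ 4) / ((r - c) ^ 3 * (r + c)) := by
    field_simp
    ring
  rw [e, div_le_div_iff₀ hDpos (by positivity)]
  have hk : r + 2 ≤ 2 * r := by linarith
  have hr3 : r ^ 2 ≤ r ^ 3 := by nlinarith [sq_nonneg r]
  have hc4 : c ^ 4 ≤ c ^ 4 * r ^ 3 := by
    have : 1 ≤ r ^ 3 := one_le_pow₀ hr1
    nlinarith [pow_nonneg hc 4]
  have hN : (4 + 2 * c) * r ^ 3 + 4 * r ^ 2 - 2 * c ^ 3 * r + c ^ 4 ≤ (8 + 2 * c + c ^ 4) * r ^ 3 := by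
    nlinarith [mul_nonneg (pow_nonneg hc 3) hr0.le]
  have hN0 : 0 ≤ (4 + 2 * c) * r ^ 3 + 4 * r ^ 2 - 2 * c ^ 3 * r + c ^ 4 := by
    have : c ^ 3 * r ≤ c ^ 2 * r ^ 2 := by
      have : c ≤ r := by linarith
      have := mul_le_mul_of_nonneg_left this (mul_nonneg (sq_nonneg c) hr0.le)
      nlinarith [this]
    nlinarith [pow_nonneg hc 4, mul_nonneg hc (pow_nonneg hr0.le 3), sq_nonneg r, sq_nonneg c,
      mul_nonneg (sq_nonneg c) (sq_nonneg r)]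
  calc 2 * ((4 + 2 * c) * r ^ 3 + 4 * r ^ 2 - 2 * c ^ 3 * r + c ^ 4) * (r + 2)
      ≤ 2 * ((8 + 2 * c + c ^ 4) * r ^ 3) * (2 * r) := by
        have := mul_le_mul hN hk (by linarith) (by positivity)
        nlinarith [this]
    _ = (8 + 2 * c + c ^ 4) / 2 * (8 * (r ^ 3 * r)) := by ring
    _ ≤ (8 + 2 * c + c ^ 4) / 2 * (8 * (8 * ((r - c) ^ 3 * (r + c)))) :=
        mul_le_mul_of_nonneg_left (by nlinarith [hD]) (by positivity)
    _ = (256 + 64 * c + 32 * c ^ 4) * ((r - c) ^ 3 * (r + c)) := by ring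

/-- `2 − (r + 2)² · 2(r + 3c)(r − c)/r⁴ ≤ 108c²/(r + 2)` for `c ≥ 0`, `r ≥ 2c + 2`. -/
theorem lower_second_envelope_le {r c : ℝ} (hc : 0 ≤ c) (hr : 2 * c + 2 ≤ r) :
    2 - (r + 2) ^ 2 * (2 * (r + 3 * c) * (r - c) / r ^ 4) ≤ 108 * c ^ 2 / (r + 2) := by
  have hr0 : 0 < r := by linarith
  have hr1 : 1 ≤ r := by linarith
  have e : 2 - (r + 2) ^ 2 * (2 * (r + 3 * c) * (r - c) / r ^ 4)
      = 2 * (-(4 + 2 * c) * r ^ 3 + (3 * c ^ 2 - 8 * c - 4) * r ^ 2 + (12 * c ^ 2 - 8 * c) * r + 12 * c ^ 2)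
        / r ^ 4 := by
    field_simp
    ring
  rw [e, div_le_div_iff₀ (by positivity) (by positivity)]
  have hN : -(4 + 2 * c) * r ^ 3 + (3 * c ^ 2 - 8 * c - 4) * r ^ 2 + (12 * c ^ 2 - 8 * c) * r + 12 * c ^ 2
      ≤ 27 * c ^ 2 * r ^ 2 := by
    nlinarith [mul_nonneg hc (pow_nonneg hr0.le 3), mul_nonneg hc (sq_nonneg r), mul_nonneg hc hr0.le,
      pow_nonneg hr0.le 3, sq_nonneg r, mul_le_mul_of_nonneg_left hr1 (sq_nonneg c),
      mul_le_mul_of_nonneg_left (mul_le_mul_of_nonneg_left hr1 hr0.le) (sq_nonneg c)]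
  have hk : r + 2 ≤ 2 * r ^ 2 := by nlinarith
  calc 2 * (-(4 + 2 * c) * r ^ 3 + (3 * c ^ 2 - 8 * c - 4) * r ^ 2 + (12 * c ^ 2 - 8 * c) * r + 12 * c ^ 2)
        * (r + 2)
      ≤ 2 * (27 * c ^ 2 * r ^ 2) * (2 * r ^ 2) := by
        rcases le_or_gt 0 (-(4 + 2 * c) * r ^ 3 + (3 * c ^ 2 - 8 * c - 4) * r ^ 2 + (12 * c ^ 2 - 8 * c) * r
            + 12 * c ^ 2) with hpos | hneg
        · have := mul_le_mul hN hk (by linarith) (by positivity)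
          nlinarith [this]
        · nlinarith [mul_nonneg (mul_nonneg (by norm_num : (0 : ℝ) ≤ 27) (sq_nonneg c)) (sq_nonneg r),
            sq_nonneg r]
    _ = 108 * c ^ 2 * r ^ 4 := by ring

section measure

variable [MeasurableSpace Circle] [BorelSpace Circle]

/-! ### The mean phase rate -/

/-- **THE RATE OF THE MEAN PHASE OUTSIDE THE JENSEN RANGE**: for `λ ≥ 2`, `k ≥ 2c' + 4`,
`|k ⟨log|a|⟩_{k,λ} − 1| ≤ (16 + 8c' + 20c'²)/k`, `c' = λ(λ − 2)/2`. -/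
theorem abs_mul_mean_phase_sub_one_le_of_two_le {k lam : ℝ} (h2 : 2 ≤ lam)
    (hk : 2 * (lam * (lam - 2) / 2) + 4 ≤ k) :
    |k * ((∫ g, Real.log ‖mat g 0 0‖ * ((1 - ‖orbit g‖ ^ 2) ^ (k / 2) * sph lam g) ∂(nu haarCircle))
        / (∫ g, (1 - ‖orbit g‖ ^ 2) ^ (k / 2) * sph lam g ∂(nu haarCircle))) - 1|
      ≤ (16 + 8 * (lam * (lam - 2) / 2) + 20 * (lam * (lam - 2) / 2) ^ 2) / k := by
  set c : ℝ := lam * (lam - 2) / 2 with hc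
  have hc0 : 0 ≤ c := by rw [hc]; exact div_nonneg (mul_nonneg (by linarith) (by linarith)) (by norm_num)
  have hr : 2 * c + 2 ≤ k - 2 := by linarith
  have hk0 : 0 < k := by linarith
  have hkc : c < k - 2 := by linarith
  have hup := mean_phase_le_of_two_le h2 hkc
  have hlo := mean_phase_ge_of_two_le h2 hkc
  rw [← hc] at hup hlo
  set m : ℝ := (∫ g, Real.log ‖mat g 0 0‖ * ((1 - ‖orbit g‖ ^ 2) ^ (k / 2) * sph lam g) ∂(nu haarCircle))
    / (∫ g, (1 - ‖orbit g‖ ^ 2) ^ (k / 2) * sph lam g ∂(nu haarCircle)) with hm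
  have hU := upper_mean_envelope_le hc0 hr
  have hL := lower_mean_envelope_le hc0 hr
  rw [show k - 2 + 2 = k by ring] at hU hL
  have h1 : k * m - 1 ≤ (16 + 8 * c + 8 * c ^ 2) / k := by
    nlinarith [mul_le_mul_of_nonneg_left hup hk0.le]
  have h2' : 1 - k * m ≤ 12 * c ^ 2 / k := by
    nlinarith [mul_le_mul_of_nonneg_left hlo hk0.le]
  have h3 : (16 + 8 * c + 8 * c ^ 2) / k ≤ (16 + 8 * c + 20 * c ^ 2) / k :=
    div_le_div_of_nonneg_right (by nlinarith [sq_nonneg c]) hk0.le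
  have h4 : 12 * c ^ 2 / k ≤ (16 + 8 * c + 20 * c ^ 2) / k :=
    div_le_div_of_nonneg_right (by nlinarith [sq_nonneg c]) hk0.le
  rw [abs_le]
  constructor <;> linarith

/-! ### The second moment -/

/-- **The second moment from below outside the Jensen range**: for `λ ≥ 2`, `r = k − 2 > c'`,
`2(r + 3c')(r − c')/r⁴ ≤ ⟨(log|a|)²⟩_{k,λ}`. -/
theorem second_moment_phase_ge_of_two_le {k lam : ℝ} (h2 : 2 ≤ lam) (hk : lam * (lam - 2) / 2 < k - 2) :
    2 * ((k - 2) + 3 * (lam * (lam - 2) / 2)) * ((k - 2) - lam * (lam - 2) / 2) / (k - 2) ^ 4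
      ≤ (∫ g, Real.log ‖mat g 0 0‖ ^ 2 * ((1 - ‖orbit g‖ ^ 2) ^ (k / 2) * sph lam g) ∂(nu haarCircle))
        / (∫ g, (1 - ‖orbit g‖ ^ 2) ^ (k / 2) * sph lam g ∂(nu haarCircle)) := by
  set c : ℝ := lam * (lam - 2) / 2 with hc
  have hc0 : 0 ≤ c := by rw [hc]; exact div_nonneg (mul_nonneg (by linarith) (by linarith)) (by norm_num)
  have hr : 0 < k - 2 := by linarith
  have hrc : 0 < k - 2 - c := by linarith
  have hk' : lam < k := by nlinarith
  rw [normalized_moment_eq_phase' 2 (k := k) (lam := lam) (by linarith) hk' (by linarith)]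
  have hA := le_moment_phase_of_two_le 2 h2 hk
  have hf3 : ((2 + 1).factorial : ℝ) = 6 := by norm_num [Nat.factorial]
  simp only [Nat.factorial_two, Nat.cast_ofNat, hf3, Nat.reduceAdd] at hA
  rw [← hc] at hA
  have hN := moment_phase_le_of_two_le 0 h2 hk
  simp only [pow_zero, one_mul, Nat.factorial_zero, Nat.cast_one, zero_add, pow_one] at hN
  rw [← hc] at hN
  have hNpos : 0 < ∫ s in Ioi (0 : ℝ), Real.exp (-((k - 2) * s)) * sphPhase lam s := by
    have h := le_moment_phase_of_two_le 0 h2 hk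
    simp only [pow_zero, one_mul, Nat.factorial_zero, Nat.cast_one, zero_add, pow_one, Nat.factorial_one,
      mul_one] at h
    refine lt_of_lt_of_le ?_ h
    positivity
  have hA' : 2 * ((k - 2) + 3 * c) / (k - 2) ^ 4
      ≤ ∫ s in Ioi (0 : ℝ), s ^ 2 * Real.exp (-((k - 2) * s)) * sphPhase lam s := by
    refine le_trans (le_of_eq ?_) hA
    field_simp
    ring
  rw [div_le_div_iff₀ (by positivity) hNpos]
  calc 2 * ((k - 2) + 3 * c) * ((k - 2) - c) * ∫ s in Ioi (0 : ℝ), Real.exp (-((k - 2) * s)) * sphPhase lam s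
      ≤ 2 * ((k - 2) + 3 * c) * ((k - 2) - c) * (1 / ((k - 2) - c)) :=
        mul_le_mul_of_nonneg_left hN (by positivity)
    _ = (2 * ((k - 2) + 3 * c) / (k - 2) ^ 4) * (k - 2) ^ 4 := by field_simp
    _ ≤ (∫ s in Ioi (0 : ℝ), s ^ 2 * Real.exp (-((k - 2) * s)) * sphPhase lam s) * (k - 2) ^ 4 :=
        mul_le_mul_of_nonneg_right hA' (by positivity)

/-- **The second moment from above outside the Jensen range**: for `λ ≥ 2`, `r = k − 2 > c'`,
`⟨(log|a|)²⟩_{k,λ} ≤ 2r²/((r − c')³(r + c'))`. -/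
theorem second_moment_phase_le_of_two_le {k lam : ℝ} (h2 : 2 ≤ lam) (hk : lam * (lam - 2) / 2 < k - 2) :
    (∫ g, Real.log ‖mat g 0 0‖ ^ 2 * ((1 - ‖orbit g‖ ^ 2) ^ (k / 2) * sph lam g) ∂(nu haarCircle))
        / (∫ g, (1 - ‖orbit g‖ ^ 2) ^ (k / 2) * sph lam g ∂(nu haarCircle))
      ≤ 2 * (k - 2) ^ 2 / (((k - 2) - lam * (lam - 2) / 2) ^ 3 * ((k - 2) + lam * (lam - 2) / 2)) := by
  set c : ℝ := lam * (lam - 2) / 2 with hc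
  have hc0 : 0 ≤ c := by rw [hc]; exact div_nonneg (mul_nonneg (by linarith) (by linarith)) (by norm_num)
  have hr : 0 < k - 2 := by linarith
  have hrc : 0 < k - 2 - c := by linarith
  have hk' : lam < k := by nlinarith
  rw [normalized_moment_eq_phase' 2 (k := k) (lam := lam) (by linarith) hk' (by linarith)]
  have hA := moment_phase_le_of_two_le 2 h2 hk
  simp only [Nat.factorial_two, Nat.cast_ofNat, Nat.reduceAdd] at hA
  rw [← hc] at hA
  have hN := le_moment_phase_of_two_le 0 h2 hk
  simp only [pow_zero, one_mul, Nat.factorial_zero, Nat.cast_one, zero_add, pow_one, Nat.factorial_one,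
    mul_one] at hN
  rw [← hc] at hN
  have hNpos : 0 < ∫ s in Ioi (0 : ℝ), Real.exp (-((k - 2) * s)) * sphPhase lam s :=
    lt_of_lt_of_le (by positivity) hN
  have hN' : ((k - 2) + c) / (k - 2) ^ 2 ≤ ∫ s in Ioi (0 : ℝ), Real.exp (-((k - 2) * s)) * sphPhase lam s := by
    refine le_trans (le_of_eq ?_) hN
    field_simp
  have hden : 0 < ((k - 2) - c) ^ 3 * ((k - 2) + c) := by positivity
  rw [div_le_div_iff₀ hNpos hden]
  calc (∫ s in Ioi (0 : ℝ), s ^ 2 * Real.exp (-((k - 2) * s)) * sphPhase lam s)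
        * (((k - 2) - c) ^ 3 * ((k - 2) + c))
      ≤ (2 / ((k - 2) - c) ^ 3) * (((k - 2) - c) ^ 3 * ((k - 2) + c)) :=
        mul_le_mul_of_nonneg_right hA hden.le
    _ = 2 * (k - 2) ^ 2 * (((k - 2) + c) / (k - 2) ^ 2) := by field_simp
    _ ≤ 2 * (k - 2) ^ 2 * ∫ s in Ioi (0 : ℝ), Real.exp (-((k - 2) * s)) * sphPhase lam s :=
        mul_le_mul_of_nonneg_left hN' (by positivity)

/-- **THE RATE OF THE SECOND MOMENT OUTSIDE THE JENSEN RANGE**: for `λ ≥ 2`, `k ≥ 2c' + 4`,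
`|k² ⟨(log|a|)²⟩_{k,λ} − 2| ≤ (256 + 64c' + 108c'² + 32c'⁴)/k`. -/
theorem abs_sq_mul_second_moment_sub_two_le_of_two_le {k lam : ℝ} (h2 : 2 ≤ lam)
    (hk : 2 * (lam * (lam - 2) / 2) + 4 ≤ k) :
    |k ^ 2 * ((∫ g, Real.log ‖mat g 0 0‖ ^ 2 * ((1 - ‖orbit g‖ ^ 2) ^ (k / 2) * sph lam g) ∂(nu haarCircle))
        / (∫ g, (1 - ‖orbit g‖ ^ 2) ^ (k / 2) * sph lam g ∂(nu haarCircle))) - 2|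
      ≤ (256 + 64 * (lam * (lam - 2) / 2) + 108 * (lam * (lam - 2) / 2) ^ 2 + 32 * (lam * (lam - 2) / 2) ^ 4)
        / k := by
  set c : ℝ := lam * (lam - 2) / 2 with hc
  have hc0 : 0 ≤ c := by rw [hc]; exact div_nonneg (mul_nonneg (by linarith) (by linarith)) (by norm_num)
  have hr : 2 * c + 2 ≤ k - 2 := by linarith
  have hk0 : 0 < k := by linarith
  have hkc : c < k - 2 := by linarith
  have hup := second_moment_phase_le_of_two_le h2 hkc
  have hlo := second_moment_phase_ge_of_two_le h2 hkc
  rw [← hc] at hup hlo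
  set m : ℝ := (∫ g, Real.log ‖mat g 0 0‖ ^ 2 * ((1 - ‖orbit g‖ ^ 2) ^ (k / 2) * sph lam g) ∂(nu haarCircle))
    / (∫ g, (1 - ‖orbit g‖ ^ 2) ^ (k / 2) * sph lam g ∂(nu haarCircle)) with hm
  have hU := upper_second_envelope_le hc0 hr
  have hL := lower_second_envelope_le hc0 hr
  rw [show k - 2 + 2 = k by ring] at hU hL
  have hkk : 0 ≤ k ^ 2 := by positivity
  have h1 : k ^ 2 * m - 2 ≤ (256 + 64 * c + 32 * c ^ 4) / k := by
    nlinarith [mul_le_mul_of_nonneg_left hup hkk]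
  have h2' : 2 - k ^ 2 * m ≤ 108 * c ^ 2 / k := by
    nlinarith [mul_le_mul_of_nonneg_left hlo hkk]
  have h3 : (256 + 64 * c + 32 * c ^ 4) / k ≤ (256 + 64 * c + 108 * c ^ 2 + 32 * c ^ 4) / k :=
    div_le_div_of_nonneg_right (by nlinarith [sq_nonneg c]) hk0.le
  have h4 : 108 * c ^ 2 / k ≤ (256 + 64 * c + 108 * c ^ 2 + 32 * c ^ 4) / k :=
    div_le_div_of_nonneg_right (by nlinarith [sq_nonneg c, pow_nonneg hc0 4]) hk0.le
  rw [abs_le]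
  constructor <;> linarith

/-! ### The twin for `λ ≤ 0` -/

/-- **The rate of the mean phase for `λ ≤ 0`** (by `φ_λ = φ_{2−λ}`). -/
theorem abs_mul_mean_phase_sub_one_le_of_nonpos {k lam : ℝ} (h0 : lam ≤ 0)
    (hk : 2 * (lam * (lam - 2) / 2) + 4 ≤ k) :
    |k * ((∫ g, Real.log ‖mat g 0 0‖ * ((1 - ‖orbit g‖ ^ 2) ^ (k / 2) * sph lam g) ∂(nu haarCircle))
        / (∫ g, (1 - ‖orbit g‖ ^ 2) ^ (k / 2) * sph lam g ∂(nu haarCircle))) - 1|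
      ≤ (16 + 8 * (lam * (lam - 2) / 2) + 20 * (lam * (lam - 2) / 2) ^ 2) / k := by
  have e : (2 - lam) * (2 - lam - 2) / 2 = lam * (lam - 2) / 2 := by ring
  have h := abs_mul_mean_phase_sub_one_le_of_two_le (lam := 2 - lam) (k := k) (by linarith) (by rw [e]; exact hk)
  rw [e] at h
  simp_rw [← sph_two_sub lam] at h
  exact h

end measure

end Summit.Ventures.HodgeRepro2.T5SU11JacobiMeanPhaseRateOutside
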